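import Summits.ResolutionOfSingularities.ResolutionOfSingularities.Theorems.RadicialJungCleanModelsF75cCurveStepNext
import Summits.ResolutionOfSingularities.ResolutionOfSingularities.Theorems.RadicialJungCleanModelsF75cPrincipalization
import HarnessLib

/-!
# [F-75c discharge, brick L1] Blowing up bad points of a curve configuration on a regular surface reaches a stage with
# no bad point (The Stacks Project, Lemma 54.15.6 = Tag 0BIC, proof ¶2 with Lemmas 54.15.1–54.15.4)

Cell res-hironaka, D-0154 INPUTS discharger `res-inputs-p-f75c` for the named fact F-75c
`Literature.AlgebraicGeometry.Resolution.Stacks0BIC_embeddedResolutionCurvesInSurfaces_locus`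
(`--supports stmt-ResolutionOfSingularities-15917 --as helper`). Printed (Tag 0BIC ¶2): singular points of the
components and non-transverse intersection points are blown up until «all irreducible components `Y` of `Z` are
regular» and «the maximum [of the `m_p(Y_i ∩ Y_j)`] is `1`». EXISTENCE form of the tree's TERMINATION theorem
`false_of_badPointChain_of_curveConfiguration` (`EmbeddedCurveConfigurationPointBlowups.lean`): from a finite
configuration `𝒞₀` of members (`cl{η}`, `η` not closed, `dim 𝒪_{X,η} = 1`) on a Noetherian regular excellent scheme
`X` of dimension `≤ 2`, a composition of blowing ups at closed points lying over `⋃ 𝒞₀` reaches a stage `(Y, 𝒞)` —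
`𝒞` = iterated strict transforms and exceptional curves, `⋃ 𝒞 = σ⁻¹(⋃ 𝒞₀)` — with NO BAD POINT: no member has a
singular point and any two distinct members meet transversally (`𝓘_{C,x} + 𝓘_{C',x} = 𝔪_x`). Proof: otherwise dependent
choice along the successor construction of bricks C1/C2 produces an infinite chain of blow-ups at bad points, which the
termination theorem forbids.

* `eq_of_subset_of_isMember` — members are pairwise incomparable; `isClosed_of_bad` — a bad point is a closed point on
  a member; **`exists_noBadPoint`** — the existence theorem.

HONEST FRAMING: bookkeeping over tree theorems; nothing here is a statement of [Hironaka2017]. AI-written; AI review is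
weaker than expert review. References: The Stacks Project, Tags 0BIC, 0BI4–0BI8 [StacksProject]; Cossart–Piltant 2008,
Prop. 4.4 steps 1–2 [CossartPiltant2008].
-/

noncomputable section

set_option linter.dupNamespace false -- mandated namespace of this single-conjunct summit

open CategoryTheory AlgebraicGeometry TopologicalSpace IsLocalRing

namespace Summit.ResolutionOfSingularities.ResolutionOfSingularities.Theorems

namespace F75c

open Literature.AlgebraicGeometry.Resolution
open Literature.AlgebraicGeometry.Resolution.CurveConfiguration
open Summit.ResolutionOfSingularities.ResolutionOfSingularities.Theorems.CP2008Prop44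
open Scheme.IdealSheafData

universe u

/-! ## Members are incomparable; bad points are closed -/

section Bad

variable {Y : Scheme.{u}}

/-- **Members are pairwise incomparable**: `cl{η} ⊆ cl{η'}` with `dim 𝒪_η = dim 𝒪_{η'} = 1` forces equality
(a proper generisation would have `coheight ≤ 0`). [cite: StacksProject, Tag 0BIC (Lemma 54.15.6, proof)] -/
theorem eq_of_subset_of_isMember {C C' : Closeds Y} {η η' : Y} (hC : (C : Set Y) = closure {η})
    (h1 : ringKrullDim (Y.presheaf.stalk η) = 1) (hC' : (C' : Set Y) = closure {η'})
    (h1' : ringKrullDim (Y.presheaf.stalk η') = 1) (hsub : (C : Set Y) ⊆ C') : C = C' := by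
  have hη : η ∈ closure ({η'} : Set Y) := hC' ▸ hsub (hC ▸ subset_closure (Set.mem_singleton η))
  have hsp : η' ⤳ η := specializes_iff_mem_closure.mpr hη
  by_cases hsp' : η ⤳ η'
  · apply Closeds.ext
    rw [hC, hC']
    exact le_antisymm (closure_minimal (Set.singleton_subset_iff.mpr hη) isClosed_closure)
      (closure_minimal (Set.singleton_subset_iff.mpr (specializes_iff_mem_closure.mp hsp')) isClosed_closure)
  · exfalso
    have hlt : η < η' := lt_iff_le_not_ge.mpr ⟨Scheme.le_iff_specializes.mpr hsp,
      fun h => hsp' (Scheme.le_iff_specializes.mp h)⟩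
    have hcoh : Order.coheight η = 1 := by
      have h := ringKrullDim_stalk_eq_coheight η; rw [h1] at h; exact_mod_cast h.symm
    have hcoh' : Order.coheight η' = 1 := by
      have h := ringKrullDim_stalk_eq_coheight η'; rw [h1'] at h; exact_mod_cast h.symm
    have := Order.coheight_add_one_le hlt
    rw [hcoh, hcoh'] at this
    exact absurd this (by decide)

/-- **A non-generic point of a member is a closed point of `Y`** (the member's reduced subscheme is an integral
Noetherian sober space of dimension `1`). [cite: StacksProject, Tag 0BIC (Lemma 54.15.6, proof)] -/
theorem isClosed_singleton_subschemeι_of_ne (C : Closeds Y) [IsIntegral (vanishingIdeal C).subscheme]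
    [IsNoetherian (vanishingIdeal C).subscheme] (hdim : topologicalKrullDim (vanishingIdeal C).subscheme = 1)
    {c : (vanishingIdeal C).subscheme} (hc : c ≠ genericPoint (vanishingIdeal C).subscheme) :
    IsClosed ({(vanishingIdeal C).subschemeι c} : Set Y) := by
  have hne : closure ({c} : Set (vanishingIdeal C).subscheme) ≠ Set.univ := by
    intro h
    exact hc ((isGenericPoint_def.mpr h).eq (genericPoint_spec _))
  have hcl : IsClosed ({c} : Set (vanishingIdeal C).subscheme) :=
    (Set.finite_and_isClosed_singleton_of_dim_le_one hdim.le isClosed_closure hne).2 c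
      (subset_closure (Set.mem_singleton c))
  rw [← Set.image_singleton]
  exact (vanishingIdeal C).subschemeι.isClosedEmbedding.isClosedMap _ hcl

/-- **A bad point is a closed point lying on a member** (a singular point of a member, or a common point of two
distinct members, is not the generic point of that member). [cite: StacksProject, Tag 0BIC (Lemma 54.15.6, proof ¶2)] -/
theorem isClosed_of_bad [IsNoetherian Y] (hqe : Scheme.IsQuasiExcellent Y) (hY2 : topologicalKrullDim Y ≤ 2)
    {𝒞 : Set (Closeds Y)}
    (hmem : ∀ C ∈ 𝒞, ∃ η : Y, (C : Set Y) = closure {η} ∧ ¬ IsClosed ({η} : Set Y) ∧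
      ringKrullDim (Y.presheaf.stalk η) = 1)
    {x : Y} {C : Closeds Y} (hC : C ∈ 𝒞)
    (hbad : x ∈ (vanishingIdeal C).subschemeι '' (Scheme.regularLocus (vanishingIdeal C).subscheme)ᶜ ∨
      (x ∈ (C : Set Y) ∧ ∃ C' ∈ 𝒞, C' ≠ C ∧ x ∈ (C' : Set Y) ∧
        stalkIdeal (vanishingIdeal C) x ⊔ stalkIdeal (vanishingIdeal C') x ≠ maximalIdeal (Y.presheaf.stalk x))) :
    IsClosed ({x} : Set Y) ∧ x ∈ (C : Set Y) := by
  obtain ⟨η, hCη, hηcl, hη1⟩ := hmem C hC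
  have hCeq : C = ⟨closure {η}, isClosed_closure⟩ := Closeds.ext hCη
  obtain ⟨hint, hnoeth, -, hdim1⟩ := member_props hqe hY2 hη1 hηcl
  rw [← hCeq] at hint hnoeth hdim1
  haveI := hint; haveI := hnoeth
  rcases hbad with ⟨c, hc, rfl⟩ | ⟨hxC, C', hC', hne, hxC', -⟩
  · exact ⟨isClosed_singleton_subschemeι_of_ne C hdim1 (ne_genericPoint_of_not_mem_regularLocus hc),
      subschemeι_mem C c⟩
  · refine ⟨?_, hxC⟩
    obtain ⟨c, rfl⟩ := exists_subschemeι_eq C hxC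
    refine isClosed_singleton_subschemeι_of_ne C hdim1 fun hc => hne ?_
    obtain ⟨η', hC'η', -, hη'1⟩ := hmem C' hC'
    rw [hc] at hxC'
    exact (eq_of_subset_of_isMember hCη hη1 hC'η' hη'1 (subset_of_subschemeι_genericPoint_mem C C' hxC')).symm

end Bad

/-! ## Reaching a stage with no bad point -/

/-- **Blowing up bad points terminates** (existence form of `false_of_badPointChain_of_curveConfiguration`, Stacks
0BIC ¶2 with 54.15.1–54.15.4): from a finite configuration `𝒞₀` of members on a Noetherian regular excellent scheme of
dimension `≤ 2`, some composition `σ : Y → X` of blowing ups at closed points lying over `⋃ 𝒞₀` carries a finite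
configuration `𝒞` of members with `⋃ 𝒞 = σ⁻¹(⋃ 𝒞₀)` and NO bad point.
[cite: StacksProject, Tag 0BIC (Lemma 54.15.6, proof ¶2)] [cite: CossartPiltant2008, Prop. 4.4 (proof, steps 1–2)] -/
theorem exists_noBadPoint (X : Scheme.{u}) [IsNoetherian X] (hreg : Scheme.IsRegular X) (hexc : Scheme.IsExcellent X)
    (hX2 : topologicalKrullDim X ≤ 2) (𝒞₀ : Set (Closeds X)) (hfin₀ : 𝒞₀.Finite)
    (hmem₀ : ∀ C ∈ 𝒞₀, ∃ η : X, (C : Set X) = closure {η} ∧ ¬ IsClosed ({η} : Set X) ∧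
      ringKrullDim (X.presheaf.stalk η) = 1) :
    ∃ (Y : Scheme.{u}) (σ : Y ⟶ X) (𝒞 : Set (Closeds Y)),
      IsPointBlowupComposition (⋃ C ∈ 𝒞₀, (C : Set X)) σ ∧ 𝒞.Finite ∧
      (∀ C ∈ 𝒞, ∃ η : Y, (C : Set Y) = closure {η} ∧ ¬ IsClosed ({η} : Set Y) ∧
        ringKrullDim (Y.presheaf.stalk η) = 1) ∧
      (⋃ C ∈ 𝒞, (C : Set Y)) = σ ⁻¹' (⋃ C ∈ 𝒞₀, (C : Set X)) ∧
      ∀ x : Y, ¬ ∃ C ∈ 𝒞,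
        x ∈ (vanishingIdeal C).subschemeι '' (Scheme.regularLocus (vanishingIdeal C).subscheme)ᶜ ∨
        (x ∈ (C : Set Y) ∧ ∃ C' ∈ 𝒞, C' ≠ C ∧ x ∈ (C' : Set Y) ∧
          stalkIdeal (vanishingIdeal C) x ⊔ stalkIdeal (vanishingIdeal C') x ≠ maximalIdeal (Y.presheaf.stalk x)) := by
  classical
  set T : Set X := ⋃ C ∈ 𝒞₀, (C : Set X) with hT
  by_contra Hc
  -- one step: from a reachable configuration, blow up a bad point
  have step : ∀ (Y : Scheme.{u}) (σ : Y ⟶ X) (𝒞 : Set (Closeds Y)), IsPointBlowupComposition T σ → 𝒞.Finite →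
      (∀ C ∈ 𝒞, ∃ η : Y, (C : Set Y) = closure {η} ∧ ¬ IsClosed ({η} : Set Y) ∧
        ringKrullDim (Y.presheaf.stalk η) = 1) →
      (⋃ C ∈ 𝒞, (C : Set Y)) = σ ⁻¹' T →
      ∃ (Y' : Scheme.{u}) (π : Y' ⟶ Y) (x : Y) (hx : IsClosed ({x} : Set Y)) (𝒞' : Set (Closeds Y')),
      (IsPointBlowupComposition T (π ≫ σ) ∧ 𝒞'.Finite ∧
        (∀ C ∈ 𝒞', ∃ η : Y', (C : Set Y') = closure {η} ∧ ¬ IsClosed ({η} : Set Y') ∧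
          ringKrullDim (Y'.presheaf.stalk η) = 1) ∧
        (⋃ C ∈ 𝒞', (C : Set Y')) = (π ≫ σ) ⁻¹' T) ∧
      IsBlowup π (vanishingIdeal ⟨{x}, hx⟩) ∧
      (∃ C ∈ 𝒞,
        x ∈ (vanishingIdeal C).subschemeι '' (Scheme.regularLocus (vanishingIdeal C).subscheme)ᶜ ∨
        (x ∈ (C : Set Y) ∧ ∃ C' ∈ 𝒞, C' ≠ C ∧ x ∈ (C' : Set Y) ∧
          stalkIdeal (vanishingIdeal C) x ⊔ stalkIdeal (vanishingIdeal C') x ≠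
            maximalIdeal (Y.presheaf.stalk x))) ∧
      (∀ C' ∈ 𝒞', (∃ C ∈ 𝒞, (C' : Set Y') = closure (π ⁻¹' ((C : Set Y) \ {x}))) ∨
        (Scheme.IsRegular (vanishingIdeal C').subscheme ∧
          ∀ D ∈ 𝒞', D ≠ C' →
            (¬ ∃ C ∈ 𝒞, (D : Set Y') = closure (π ⁻¹' ((C : Set Y) \ {x})) ∧
                x ∈ (vanishingIdeal C).subschemeι '' (Scheme.regularLocus (vanishingIdeal C).subscheme)ᶜ) →
            ∀ q ∈ (C' : Set Y') ∩ (D : Set Y'),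
              stalkIdeal (vanishingIdeal C') q ⊔ stalkIdeal (vanishingIdeal D) q =
                maximalIdeal (Y'.presheaf.stalk q))) := by
    intro Y σ 𝒞 hIPC hfin hmem hU
    obtain ⟨hN, hregY, hexcY, hY2⟩ := IsPointBlowupComposition.invariants hIPC hreg hexc hX2
    haveI := hN
    have hqeY := hexcY.isQuasiExcellent
    -- a bad point (else `(Y, σ, 𝒞)` would do)
    have hbad : ∃ x : Y, ∃ C ∈ 𝒞,
        x ∈ (vanishingIdeal C).subschemeι '' (Scheme.regularLocus (vanishingIdeal C).subscheme)ᶜ ∨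
        (x ∈ (C : Set Y) ∧ ∃ C' ∈ 𝒞, C' ≠ C ∧ x ∈ (C' : Set Y) ∧
          stalkIdeal (vanishingIdeal C) x ⊔ stalkIdeal (vanishingIdeal C') x ≠ maximalIdeal (Y.presheaf.stalk x)) := by
      by_contra h
      exact Hc ⟨Y, σ, 𝒞, hIPC, hfin, hmem, hU, fun x hx => h ⟨x, hx⟩⟩
    obtain ⟨x, C₀, hC₀, hxbad⟩ := hbad
    obtain ⟨hxcl, hxC₀⟩ := isClosed_of_bad hqeY hY2 hmem hC₀ hxbad
    obtain ⟨η₀, hC₀η, hη₀cl, hη₀1⟩ := hmem C₀ hC₀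
    have hx2 : ringKrullDim (Y.presheaf.stalk x) = 2 :=
      ringKrullDim_stalk_eq_two_of_mem_closure hY2 hη₀1 hxcl hη₀cl (hC₀η ▸ hxC₀)
    have hxne : ({x} : Set Y) ≠ Set.univ := by
      intro h
      have : η₀ ∈ ({x} : Set Y) := h ▸ Set.mem_univ _
      rw [Set.mem_singleton_iff] at this
      exact hη₀cl (this ▸ hxcl)
    have hxT : σ x ∈ T := by
      rw [← Set.mem_preimage, ← hU]
      exact Set.mem_biUnion hC₀ hxC₀
    obtain ⟨Y', π, hπ⟩ := exists_isBlowup Y (vanishingIdeal ⟨{x}, hxcl⟩)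
    haveI : IsProper π := hπ.isProper
    haveI : IsLocallyNoetherian Y' := LocallyOfFiniteType.isLocallyNoetherian π
    have hIPC' : IsPointBlowupComposition T (π ≫ σ) := IsPointBlowupComposition.cons π σ x hxcl hIPC hxne hxT hπ
    have hfin' : ((fun C : Closeds Y => (⟨closure (π ⁻¹' ((C : Set Y) \ {x})), isClosed_closure⟩ : Closeds Y')) '' 𝒞 ∪
        {⟨π ⁻¹' {x}, hxcl.preimage π.continuous⟩}).Finite := (hfin.image _).union (Set.finite_singleton _)
    have hmem' : ∀ C' ∈ (fun C : Closeds Y => (⟨closure (π ⁻¹' ((C : Set Y) \ {x})), isClosed_closure⟩ : Closeds Y')) ''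
          𝒞 ∪ {⟨π ⁻¹' {x}, hxcl.preimage π.continuous⟩},
        ∃ η : Y', (C' : Set Y') = closure {η} ∧ ¬ IsClosed ({η} : Set Y') ∧
          ringKrullDim (Y'.presheaf.stalk η) = 1 := by
      rintro C' (⟨C, hC, rfl⟩ | hC')
      · obtain ⟨η, hCη, hηcl, hη1⟩ := hmem C hC
        obtain ⟨η', -, hst, hη'cl, hη'1⟩ := strictTransform_isMember hπ hη1 hηcl
        refine ⟨η', ?_, hη'cl, hη'1⟩
        change closure (π ⁻¹' ((C : Set Y) \ {x})) = closure {η'}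
        rw [hCη, hst]
      · rw [Set.mem_singleton_iff] at hC'
        subst hC'
        obtain ⟨η', hE, hη'cl, hη'1⟩ := exceptional_isMember hregY hπ hx2
        exact ⟨η', hE, hη'cl, hη'1⟩
    have hU' : (⋃ C' ∈ (fun C : Closeds Y => (⟨closure (π ⁻¹' ((C : Set Y) \ {x})), isClosed_closure⟩ : Closeds Y')) ''
          𝒞 ∪ {⟨π ⁻¹' {x}, hxcl.preimage π.continuous⟩}, (C' : Set Y')) = (π ≫ σ) ⁻¹' T := by
      rw [Scheme.Hom.comp_base, TopCat.coe_comp, Set.preimage_comp, ← hU,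
        ← biUnion_strictTransform_union_exceptional_eq π 𝒞 ⟨C₀, hC₀, hxC₀⟩, Set.biUnion_union,
        Set.biUnion_image, Set.biUnion_singleton]
      rfl
    exact ⟨Y', π, x, hxcl, _, ⟨hIPC', hfin', hmem', hU'⟩, hπ, ⟨C₀, hC₀, hxbad⟩, fun C' hC' =>
      successor_rule hregY hqeY hY2 hπ hmem C' hC'⟩
  -- dependent choice: an infinite chain of blow-ups at bad points
  choose Yn πn xn hxn 𝒞n hSn hπn hbadn hnextn using step
  let S : Type (u + 1) := Σ' (Y : Scheme.{u}) (σ : Y ⟶ X) (𝒞 : Set (Closeds Y)),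
    IsPointBlowupComposition T σ ∧ 𝒞.Finite ∧
      (∀ C ∈ 𝒞, ∃ η : Y, (C : Set Y) = closure {η} ∧ ¬ IsClosed ({η} : Set Y) ∧
        ringKrullDim (Y.presheaf.stalk η) = 1) ∧
      (⋃ C ∈ 𝒞, (C : Set Y)) = σ ⁻¹' T
  let next : S → S := fun s =>
    ⟨Yn s.1 s.2.1 s.2.2.1 s.2.2.2.1 s.2.2.2.2.1 s.2.2.2.2.2.1 s.2.2.2.2.2.2,
      πn s.1 s.2.1 s.2.2.1 s.2.2.2.1 s.2.2.2.2.1 s.2.2.2.2.2.1 s.2.2.2.2.2.2 ≫ s.2.1,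
      𝒞n s.1 s.2.1 s.2.2.1 s.2.2.2.1 s.2.2.2.2.1 s.2.2.2.2.2.1 s.2.2.2.2.2.2,
      hSn s.1 s.2.1 s.2.2.1 s.2.2.2.1 s.2.2.2.2.1 s.2.2.2.2.2.1 s.2.2.2.2.2.2⟩
  have hT0 : (⋃ C ∈ 𝒞₀, (C : Set X)) = (𝟙 X : X ⟶ X) ⁻¹' T := by
    rw [hT]; ext; simp
  let s₀ : S := ⟨X, 𝟙 X, 𝒞₀, IsPointBlowupComposition.nil, hfin₀, hmem₀, hT0⟩
  let ch : ℕ → S := fun n => Nat.rec s₀ (fun _ s => next s) n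
  -- stage invariants
  have hinv : ∀ n, IsNoetherian (ch n).1 ∧ Scheme.IsRegular (ch n).1 ∧ Scheme.IsExcellent (ch n).1 ∧
      topologicalKrullDim (ch n).1 ≤ 2 := fun n =>
    IsPointBlowupComposition.invariants (ch n).2.2.2.1 hreg hexc hX2
  haveI : ∀ n, IsNoetherian (ch n).1 := fun n => (hinv n).1
  have hmemn : ∀ n, ∀ C ∈ (ch n).2.2.1, ∃ η : (ch n).1, (C : Set (ch n).1) = closure {η} ∧
      ¬ IsClosed ({η} : Set (ch n).1) ∧ ringKrullDim ((ch n).1.presheaf.stalk η) = 1 :=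
    fun n => (ch n).2.2.2.2.2.1
  have hprops : ∀ n, ∀ C ∈ (ch n).2.2.1, IsIntegral (vanishingIdeal C).subscheme ∧
      IsNoetherian (vanishingIdeal C).subscheme ∧ Scheme.IsQuasiExcellent (vanishingIdeal C).subscheme ∧
      topologicalKrullDim (vanishingIdeal C).subscheme = 1 := by
    intro n C hC
    obtain ⟨η, hCη, hηcl, hη1⟩ := hmemn n C hC
    have hCeq : C = ⟨closure {η}, isClosed_closure⟩ := Closeds.ext hCη
    rw [hCeq]
    exact member_props (hinv n).2.2.1.isQuasiExcellent (hinv n).2.2.2 hη1 hηcl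
  refine false_of_badPointChain_of_curveConfiguration (fun n => (ch n).1)
    (fun n => πn (ch n).1 (ch n).2.1 (ch n).2.2.1 (ch n).2.2.2.1 (ch n).2.2.2.2.1 (ch n).2.2.2.2.2.1
      (ch n).2.2.2.2.2.2)
    (fun n => xn (ch n).1 (ch n).2.1 (ch n).2.2.1 (ch n).2.2.2.1 (ch n).2.2.2.2.1 (ch n).2.2.2.2.2.1
      (ch n).2.2.2.2.2.2)
    (fun n => hxn (ch n).1 (ch n).2.1 (ch n).2.2.1 (ch n).2.2.2.1 (ch n).2.2.2.2.1 (ch n).2.2.2.2.2.1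
      (ch n).2.2.2.2.2.2)
    (fun n => hπn (ch n).1 (ch n).2.1 (ch n).2.2.1 (ch n).2.2.2.1 (ch n).2.2.2.2.1 (ch n).2.2.2.2.2.1
      (ch n).2.2.2.2.2.2)
    (fun n => (ch n).2.2.1) (fun n => (ch n).2.2.2.2.1)
    (fun n C hC => (hprops n C hC).1) (fun n C hC => (hprops n C hC).2.1) (fun n C hC => (hprops n C hC).2.2.1)
    (fun n C hC => (hprops n C hC).2.2.2) (fun n C hC C' hC' hsub => ?_)
    (fun n => hbadn (ch n).1 (ch n).2.1 (ch n).2.2.1 (ch n).2.2.2.1 (ch n).2.2.2.2.1 (ch n).2.2.2.2.2.1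
      (ch n).2.2.2.2.2.2)
    (fun n C' hC' => hnextn (ch n).1 (ch n).2.1 (ch n).2.2.1 (ch n).2.2.2.1 (ch n).2.2.2.2.1 (ch n).2.2.2.2.2.1
      (ch n).2.2.2.2.2.2 C' hC')
  obtain ⟨η, hCη, -, hη1⟩ := hmemn n C hC
  obtain ⟨η', hC'η', -, hη'1⟩ := hmemn n C' hC'
  exact eq_of_subset_of_isMember hCη hη1 hC'η' hη'1 hsub

end F75c

end Summit.ResolutionOfSingularities.ResolutionOfSingularities.Theorems

end
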